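import Mathlib
import HarnessLib
import Summits.ValiantsHypothesis.ValiantsHypothesis.Theorems.LacunarySymmetroidMatrixDescartesProductPlusOneRowLawsK
import Summits.ValiantsHypothesis.ValiantsHypothesis.Theorems.LacunarySymmetroidMatrixDescartesProductPlusOneRowTowerKCumulant

/-!
# LINE (A) `product_plus_one` — the row-law engine at a FREE THRESHOLD `p`, and the row laws of the rate-window menu (every support size)

✓ `…RowLawsK` runs the θ-shell at the base rate `p = d 1 − d 0`.  Here the threshold is any `p : ℕ`, `0 < p` (the pen's ORDER-2 REMARK: with `p` between
the fastest knee and the slowest pole of the company, `θ² − p²` is sign-definite on every admissible row at once):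

* §1 ★ `wronskianK_no_three_zeros_of_rowLawsAt` / ★ `wronskianK_roots_le_two_of_rowLawsAt` — per-row laws «stripped row `≠ 0` and `p²ψ₁ < ψ₃` on
  `(u,v)`» ⇒ `W(∏_j f_j)` has no three / at most two roots in `(u,v)` (same proof as ✓ `wronskianK_no_three_zeros_of_rowLaws`);
* §2 the row laws at threshold `p`: `rowLawAt_neg_iff` (flipping a row's signs changes nothing), ★ `rowLawsAt_coherent` (all coefficients `≥ 0`, two
  active letters, all active letters inside a `d`-window of width `≤ p` — knees and MULTI-KNEES, by the coherent window law ✓ `rowPsiK3_gt_of_coherent`),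
  `rowLawsAt_single_pole` (binomial pole on `(d₀, d_{l₀+1})` of rate `≥ p`, root outside), `rowLawsAt_pair_pole` (binomial pole on `(d_{i+1}, d_{j+1})`
  of rate `≥ p`, root outside; ✓ `rowPsiK3_pair_law`), `rowLawsAt_cloud` (`b₀ > 0`, tail `≤ 0` with every ACTIVE rate `≥ p`, window left of the root;
  ✓ `rowPsiK3_gt_support`).

Honest framing: engine + row lemmas for W-cells (helpers); nothing closes a stub; `OneChangeFloorK3` / `WronskianBudgetK3` / 18050 / `MatrixDescartes` OPEN;
`VP ≠ VNP` NOT proved.  No definitions, no named facts.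
-/

set_option linter.dupNamespace false

namespace Summit.ValiantsHypothesis.ValiantsHypothesis.Theorems.LacunarySymmetroidMatrixDescartes

namespace ProductPlusOne

open Finset Set Polynomial
open scoped BigOperators Topology Polynomial

/-! ### §1 The engine at threshold `p` -/

/-- ★ **ENGINE at threshold `p`**: per-row laws («stripped row `≠ 0` and `p²ψ₁ < ψ₃` on the window», `0 < p`) ⇒ `W(∏_j f_j)` has no three roots in `(u,v)`
(`0 < m`). [this file's theorem] -/
theorem wronskianK_no_three_zeros_of_rowLawsAt {m n : ℕ} (hm : 0 < m) (d : Fin (n + 2) → ℕ) (hd : StrictMono d)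
    (a : Fin m → Fin (n + 2) → ℝ) {u v : ℝ} (hu : 0 < u) (p : ℕ) (hp : 0 < p)
    (hlaws : ∀ j, ∀ x ∈ Ioo u v,
      a j 0 - ∑ l : Fin (n + 1), (-(a j l.succ)) * x ^ (d l.succ - d 0) ≠ 0 ∧
      (p : ℝ) ^ 2 * rowPsiK1 (fun l : Fin (n + 1) => d l.succ - d 0) (a j 0) (fun l : Fin (n + 1) => -(a j l.succ)) x
        < rowPsiK3 (fun l : Fin (n + 1) => d l.succ - d 0) (a j 0) (fun l : Fin (n + 1) => -(a j l.succ)) x)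
    {x₁ x₂ x₃ : ℝ} (h₁ : x₁ ∈ Ioo u v) (h₃ : x₃ ∈ Ioo u v) (h12' : x₁ < x₂) (h23 : x₂ < x₃)
    (hzero : ∀ x ∈ ({x₁, x₂, x₃} : Set ℝ),
      ((∏ j, ∑ l, C (a j l) * X ^ (d l) : ℝ[X]) * (X * derivative (X * derivative (∏ j, ∑ l, C (a j l) * X ^ (d l) : ℝ[X])))
        - (X * derivative (∏ j, ∑ l, C (a j l) * X ^ (d l) : ℝ[X])) ^ 2).eval x = 0) : False := by
  classical
  have hd0 : ∀ l, d 0 ≤ d l := fun l => hd.monotone (Fin.zero_le l)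
  have hcast : (((p - 1 : ℕ) : ℝ) + 1) = (p : ℝ) := by
    have h : p - 1 + 1 = p := Nat.sub_add_cancel hp
    exact_mod_cast congrArg (fun k : ℕ => (k : ℝ)) h
  have hIoo : ∀ x ∈ ({x₁, x₂, x₃} : Set ℝ), x ∈ Ioo u v := by
    have h₂ : x₂ ∈ Ioo u v := ⟨h₁.1.trans h12', h23.trans h₃.2⟩
    intro x hx
    simp only [Set.mem_insert_iff, Set.mem_singleton_iff] at hx
    rcases hx with h | h | h <;> subst h <;> assumption
  have hev : ∀ j x, (∑ l, C (a j l) * X ^ (d l) : ℝ[X]).eval x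
      = x ^ (d 0) * (a j 0 - ∑ l : Fin (n + 1), (-(a j l.succ)) * x ^ (d l.succ - d 0)) := fun j x => eval_rowK_eq d hd0 (a j) x
  have hf : ∀ x ∈ Ioo u v, ∀ j, (∑ l, C (a j l) * X ^ (d l) : ℝ[X]).eval x ≠ 0 := by
    intro x hx j
    rw [hev]
    exact mul_ne_zero (pow_ne_zero _ (hu.trans hx.1).ne') (hlaws j x hx).1
  have hsum : ∀ x ∈ ({x₁, x₂, x₃} : Set ℝ),
      ∑ j, rowPsiK1 (fun l : Fin (n + 1) => d l.succ - d 0) (a j 0) (fun l : Fin (n + 1) => -(a j l.succ)) x = 0 := by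
    intro x hx
    have hxI := hIoo x hx
    have hx0 : 0 < x := hu.trans hxI.1
    have h := hzero x hx
    rw [logWronskian_prodK_eq_rowPsiK1_sum d hd0 a hx0 (hf x hxI)] at h
    have hP : ((∏ j, (∑ l, C (a j l) * X ^ (d l) : ℝ[X])).eval x) ≠ 0 := by
      rw [eval_prod]; exact Finset.prod_ne_zero_iff.2 fun j _ => hf x hxI j
    rcases mul_eq_zero.1 h with h1 | h1
    · exact absurd (neg_eq_zero.1 h1) (pow_ne_zero 2 hP)
    · exact h1
  refine no_three_zeros_of_theta_sq_law (p - 1) hu.le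
    (S := fun x => ∑ j, rowPsiK1 (fun l : Fin (n + 1) => d l.succ - d 0) (a j 0) (fun l : Fin (n + 1) => -(a j l.succ)) x)
    (S₁ := fun x => ∑ j, rowPsiK2 (fun l : Fin (n + 1) => d l.succ - d 0) (a j 0) (fun l : Fin (n + 1) => -(a j l.succ)) x)
    (S₂ := fun x => ∑ j, rowPsiK3 (fun l : Fin (n + 1) => d l.succ - d 0) (a j 0) (fun l : Fin (n + 1) => -(a j l.succ)) x)
    ?_ ?_ ?_ h₁ h₃ h12' h23 (hsum x₁ (by simp)) (hsum x₂ (by simp)) (hsum x₃ (by simp))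
  · intro x hx
    have hx0 : x ≠ 0 := (hu.trans hx.1).ne'
    have h := HasDerivAt.fun_sum (u := Finset.univ)
      (fun j _ => hasDerivAt_rowPsiK1 (fun l : Fin (n + 1) => d l.succ - d 0) (a j 0) (fun l : Fin (n + 1) => -(a j l.succ)) hx0
        (hlaws j x hx).1)
    simpa only [Finset.sum_div] using h
  · intro x hx
    have hx0 : x ≠ 0 := (hu.trans hx.1).ne'
    have h := HasDerivAt.fun_sum (u := Finset.univ)
      (fun j _ => hasDerivAt_rowPsiK2 (fun l : Fin (n + 1) => d l.succ - d 0) (a j 0) (fun l : Fin (n + 1) => -(a j l.succ)) hx0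
        (hlaws j x hx).1)
    simpa only [Finset.sum_div] using h
  · intro x hx
    rw [hcast, Finset.mul_sum]
    exact Finset.sum_lt_sum (fun j _ => (hlaws j x hx).2.le) ⟨⟨0, hm⟩, Finset.mem_univ _, (hlaws _ x hx).2⟩

/-- ★ **ENGINE at threshold `p`, counting form**: per-row laws on `(u,v)` ⇒ `W(∏_j f_j)` has AT MOST TWO roots in `(u,v)` (any `m`). [this file's theorem] -/
theorem wronskianK_roots_le_two_of_rowLawsAt {m n : ℕ} (d : Fin (n + 2) → ℕ) (hd : StrictMono d)
    (a : Fin m → Fin (n + 2) → ℝ) {u v : ℝ} (hu : 0 < u) (p : ℕ) (hp : 0 < p)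
    (hlaws : ∀ j, ∀ x ∈ Ioo u v,
      a j 0 - ∑ l : Fin (n + 1), (-(a j l.succ)) * x ^ (d l.succ - d 0) ≠ 0 ∧
      (p : ℝ) ^ 2 * rowPsiK1 (fun l : Fin (n + 1) => d l.succ - d 0) (a j 0) (fun l : Fin (n + 1) => -(a j l.succ)) x
        < rowPsiK3 (fun l : Fin (n + 1) => d l.succ - d 0) (a j 0) (fun l : Fin (n + 1) => -(a j l.succ)) x) :
    (((∏ j, ∑ l, C (a j l) * X ^ (d l) : ℝ[X]) * (X * derivative (X * derivative (∏ j, ∑ l, C (a j l) * X ^ (d l) : ℝ[X])))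
        - (X * derivative (∏ j, ∑ l, C (a j l) * X ^ (d l) : ℝ[X])) ^ 2).roots.toFinset.filter (fun t => u < t ∧ t < v)).card ≤ 2 := by
  classical
  set W : ℝ[X] := (∏ j, ∑ l, C (a j l) * X ^ (d l) : ℝ[X]) * (X * derivative (X * derivative (∏ j, ∑ l, C (a j l) * X ^ (d l) : ℝ[X])))
      - (X * derivative (∏ j, ∑ l, C (a j l) * X ^ (d l) : ℝ[X])) ^ 2 with hWdef
  by_contra hgt
  push Not at hgt
  obtain ⟨y₁, hy₁, y₂, hy₂, y₃, hy₃, h12', h23⟩ := exists_three_lt_of_card (T := W.roots.toFinset.filter (fun t => u < t ∧ t < v)) hgt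
  by_cases hW0 : W = 0
  · rw [hW0, roots_zero, Multiset.toFinset_zero, Finset.filter_empty] at hy₁; exact absurd hy₁ (Finset.notMem_empty _)
  have hm : 0 < m := by
    rcases Nat.eq_zero_or_pos m with h0 | hpos
    · subst h0
      exact absurd (by rw [hWdef]; simp) hW0
    · exact hpos
  rw [mem_filter, Multiset.mem_toFinset, mem_roots hW0] at hy₁ hy₂ hy₃
  refine wronskianK_no_three_zeros_of_rowLawsAt hm d hd a hu p hp hlaws (x₁ := y₁) (x₂ := y₂) (x₃ := y₃) hy₁.2 hy₃.2 h12' h23 ?_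
  intro x hx
  simp only [Set.mem_insert_iff, Set.mem_singleton_iff] at hx
  rcases hx with h | h | h <;> subst h
  · exact hy₁.1
  · exact hy₂.1
  · exact hy₃.1

/-! ### §2 The row laws at threshold `p` -/

/-- Flipping all signs of a row changes neither the non-vanishing nor the law (`ψ₁`, `ψ₃` are even in the row). [this file's lemma] -/
theorem rowLawAt_neg_iff {n : ℕ} (d : Fin (n + 2) → ℕ) (b : Fin (n + 2) → ℝ) (p : ℝ) (x : ℝ) :
    ((-b 0) - ∑ l : Fin (n + 1), (-(-b l.succ)) * x ^ (d l.succ - d 0) ≠ 0 ∧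
      p ^ 2 * rowPsiK1 (fun l : Fin (n + 1) => d l.succ - d 0) (-b 0) (fun l : Fin (n + 1) => -(-b l.succ)) x
        < rowPsiK3 (fun l : Fin (n + 1) => d l.succ - d 0) (-b 0) (fun l : Fin (n + 1) => -(-b l.succ)) x) ↔
    (b 0 - ∑ l : Fin (n + 1), (-(b l.succ)) * x ^ (d l.succ - d 0) ≠ 0 ∧
      p ^ 2 * rowPsiK1 (fun l : Fin (n + 1) => d l.succ - d 0) (b 0) (fun l : Fin (n + 1) => -(b l.succ)) x
        < rowPsiK3 (fun l : Fin (n + 1) => d l.succ - d 0) (b 0) (fun l : Fin (n + 1) => -(b l.succ)) x) := by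
  have h1 := rowPsiK1_neg (fun l : Fin (n + 1) => d l.succ - d 0) (b 0) (fun l : Fin (n + 1) => -(b l.succ)) x
  have h3 := rowPsiK3_neg (fun l : Fin (n + 1) => d l.succ - d 0) (b 0) (fun l : Fin (n + 1) => -(b l.succ)) x
  have hr := row_neg (fun l : Fin (n + 1) => d l.succ - d 0) (b 0) (fun l : Fin (n + 1) => -(b l.succ)) x
  rw [h1, h3, hr, neg_ne_zero]

/-- ★ **ROW LAW, coherent row** (all coefficients `≥ 0`, at least two active letters, every two active letters within a `d`-window of width `≤ p` —
single knees, pair knees and MULTI-KNEES): on `x > 0` the stripped row is positive and `p²ψ₁ < ψ₃` (coherent window law ✓ `rowPsiK3_gt_of_coherent`,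
`ψ₁ < 0` by ✓ `rowPsiK1_neg_of_coherent`). [this file's theorem] -/
theorem rowLawsAt_coherent {n : ℕ} (d : Fin (n + 2) → ℕ) (hd : StrictMono d) (b : Fin (n + 2) → ℝ) (p : ℕ)
    (hpos : ∀ l, 0 ≤ b l) (hact : ∃ l l', l ≠ l' ∧ b l ≠ 0 ∧ b l' ≠ 0)
    (hwin : ∀ l l', b l ≠ 0 → b l' ≠ 0 → d l' ≤ d l + p) {x : ℝ} (hx0 : 0 < x) :
    b 0 - ∑ l : Fin (n + 1), (-(b l.succ)) * x ^ (d l.succ - d 0) ≠ 0 ∧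
    (p : ℝ) ^ 2 * rowPsiK1 (fun l : Fin (n + 1) => d l.succ - d 0) (b 0) (fun l : Fin (n + 1) => -(b l.succ)) x
      < rowPsiK3 (fun l : Fin (n + 1) => d l.succ - d 0) (b 0) (fun l : Fin (n + 1) => -(b l.succ)) x := by
  classical
  have hd0 : ∀ l, d 0 ≤ d l := fun l => hd.monotone (Fin.zero_le l)
  set lam : Fin (n + 1) → ℕ := fun l => d l.succ - d 0 with hlam
  set B : Fin (n + 1) → ℝ := fun l => -(b l.succ) with hBdef
  have hB : ∀ l, B l ≤ 0 := fun l => by simp only [hBdef]; linarith [hpos l.succ]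
  have hBne : ∀ l, B l ≠ 0 ↔ b l.succ ≠ 0 := fun l => by simp [hBdef]
  -- the stripped row is positive
  have hF : 0 < b 0 - ∑ l : Fin (n + 1), B l * x ^ (lam l) := by
    have hterm : ∀ l : Fin (n + 1), 0 ≤ -(B l * x ^ (lam l)) := fun l => by
      have := mul_nonpos_of_nonpos_of_nonneg (hB l) (pow_pos hx0 (lam l)).le; linarith
    have hS : 0 ≤ -∑ l : Fin (n + 1), B l * x ^ (lam l) := by
      rw [← Finset.sum_neg_distrib]; exact Finset.sum_nonneg fun l _ => hterm l
    obtain ⟨l, l', hll', hl, hl'⟩ := hact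
    -- one of the two active letters is a tail letter
    obtain ⟨k, hk⟩ : ∃ k : Fin (n + 1), b k.succ ≠ 0 := by
      rcases Fin.eq_zero_or_eq_succ l with h | ⟨k, hk⟩
      · rcases Fin.eq_zero_or_eq_succ l' with h' | ⟨k', hk'⟩
        · exact absurd (h.trans h'.symm) hll'
        · exact ⟨k', by rw [← hk']; exact hl'⟩
      · exact ⟨k, by rw [← hk]; exact hl⟩
    have hkpos : 0 < -(B k * x ^ (lam k)) := by
      have hbk : 0 < b k.succ := lt_of_le_of_ne (hpos k.succ) (Ne.symm hk)
      simp only [hBdef, neg_mul, neg_neg]; positivity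
    have hS' : -(B k * x ^ (lam k)) ≤ -∑ l : Fin (n + 1), B l * x ^ (lam l) := by
      rw [← Finset.sum_neg_distrib]
      exact Finset.single_le_sum (fun l _ => hterm l) (Finset.mem_univ k)
    linarith [hpos 0]
  refine ⟨hF.ne', ?_⟩
  -- the window `[β, β + p]`, `β = d l₀ − d 0` for an active letter `l₀` of least degree
  have hact2 := hact
  obtain ⟨l₁, -, -, hl₁, -⟩ := hact
  obtain ⟨l₀, hl₀mem, hl₀min⟩ := Finset.exists_min_image (Finset.univ.filter fun l => b l ≠ 0) d
    ⟨l₁, Finset.mem_filter.2 ⟨Finset.mem_univ _, hl₁⟩⟩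
  have hl₀ : b l₀ ≠ 0 := (Finset.mem_filter.1 hl₀mem).2
  have hmin : ∀ l, b l ≠ 0 → d l₀ ≤ d l := fun l hl => hl₀min l (Finset.mem_filter.2 ⟨Finset.mem_univ _, hl⟩)
  set β : ℝ := ((d l₀ : ℕ) : ℝ) - ((d 0 : ℕ) : ℝ) with hβ
  have hcastlam : ∀ l : Fin (n + 1), ((lam l : ℕ) : ℝ) = ((d l.succ : ℕ) : ℝ) - ((d 0 : ℕ) : ℝ) := fun l => by
    simp only [hlam]; rw [Nat.cast_sub (hd0 l.succ)]
  have h0 : b 0 ≠ 0 → β ≤ 0 ∧ (0 : ℝ) ≤ β + p := by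
    intro hb0
    have h1 : d l₀ ≤ d 0 := hmin 0 hb0
    have h2 : d 0 ≤ d l₀ := hd0 l₀
    have h1' : ((d l₀ : ℕ) : ℝ) ≤ ((d 0 : ℕ) : ℝ) := by exact_mod_cast h1
    have h2' : ((d 0 : ℕ) : ℝ) ≤ ((d l₀ : ℕ) : ℝ) := by exact_mod_cast h2
    have hp0 : (0 : ℝ) ≤ (p : ℝ) := Nat.cast_nonneg p
    constructor <;> simp only [hβ] <;> linarith
  have hwin' : ∀ l : Fin (n + 1), B l ≠ 0 → β ≤ ((lam l : ℕ) : ℝ) ∧ ((lam l : ℕ) : ℝ) ≤ β + p := by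
    intro l hl
    have hbl : b l.succ ≠ 0 := (hBne l).1 hl
    have h1 : d l₀ ≤ d l.succ := hmin l.succ hbl
    have h2 : d l.succ ≤ d l₀ + p := hwin l₀ l.succ hl₀ hbl
    have h1' : ((d l₀ : ℕ) : ℝ) ≤ ((d l.succ : ℕ) : ℝ) := by exact_mod_cast h1
    have h2' : ((d l.succ : ℕ) : ℝ) ≤ ((d l₀ : ℕ) : ℝ) + (p : ℝ) := by exact_mod_cast h2
    rw [hcastlam l]
    constructor <;> simp only [hβ] <;> linarith
  -- two distinct active rates
  have hlam_inj : ∀ l l' : Fin (n + 1), l ≠ l' → lam l ≠ lam l' := by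
    intro l l' hll' h
    have h' : d l.succ = d l'.succ := by
      have := hd0 l.succ; have := hd0 l'.succ
      simp only [hlam] at h; omega
    exact hll' (Fin.succ_injective _ (hd.injective h'))
  have hlam_ne : ∀ l : Fin (n + 1), lam l ≠ 0 := by
    intro l
    have : d 0 < d l.succ := hd (Fin.succ_pos l)
    simp only [hlam]; omega
  have hact' : (∃ l l', B l ≠ 0 ∧ B l' ≠ 0 ∧ lam l ≠ lam l') ∨ (b 0 ≠ 0 ∧ ∃ l, B l ≠ 0 ∧ lam l ≠ 0) := by
    obtain ⟨l, l', hll', hl, hl'⟩ := hact2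
    rcases Fin.eq_zero_or_eq_succ l with h | ⟨k, hk⟩
    · rcases Fin.eq_zero_or_eq_succ l' with h' | ⟨k', hk'⟩
      · exact absurd (h.trans h'.symm) hll'
      · subst h; subst hk'
        exact Or.inr ⟨hl, k', (hBne k').2 hl', hlam_ne k'⟩
    · rcases Fin.eq_zero_or_eq_succ l' with h' | ⟨k', hk'⟩
      · subst h'; subst hk
        exact Or.inr ⟨hl', k, (hBne k).2 hl, hlam_ne k⟩
      · subst hk; subst hk'
        have hkk' : k ≠ k' := fun h => hll' (by rw [h])
        exact Or.inl ⟨k, k', (hBne k).2 hl, (hBne k').2 hl', hlam_inj k k' hkk'⟩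
  have hψ : rowPsiK1 lam (b 0) B x < 0 := rowPsiK1_neg_of_coherent lam (b 0) B hx0 (hpos 0) hB hF hact'
  exact rowPsiK3_gt_of_coherent lam (b 0) B (p : ℝ) β hx0 (hpos 0) hB h0 hwin' hF hψ.ne

/-- **ROW LAW, binomial pole with the bottom letter** (`b₀·b_{l₀+1} < 0`, other tail letters zero, rate `d_{l₀+1} − d₀ ≥ p`, root outside `(u,v)`):
on `(u,v)` the stripped row is non-zero and `p²ψ₁ < ψ₃` (`ψ₃ − λ²ψ₁ = 6ψ₁²`, `ψ₁ > 0`). [this file's theorem] -/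
theorem rowLawsAt_single_pole {n : ℕ} (d : Fin (n + 2) → ℕ) (hd : StrictMono d) (b : Fin (n + 2) → ℝ) {u v : ℝ} (hu : 0 < u) (p : ℕ)
    (l₀ : Fin (n + 1)) (hzero : ∀ l : Fin (n + 1), l ≠ l₀ → b l.succ = 0) (hpole : b 0 * b l₀.succ < 0) (hrate : p ≤ d l₀.succ - d 0)
    (hend : 0 ≤ (∑ l, C (b l) * X ^ (d l) : ℝ[X]).eval u * (∑ l, C (b l) * X ^ (d l) : ℝ[X]).eval v)
    {x : ℝ} (hx : x ∈ Ioo u v) :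
    b 0 - ∑ l : Fin (n + 1), (-(b l.succ)) * x ^ (d l.succ - d 0) ≠ 0 ∧
    (p : ℝ) ^ 2 * rowPsiK1 (fun l : Fin (n + 1) => d l.succ - d 0) (b 0) (fun l : Fin (n + 1) => -(b l.succ)) x
      < rowPsiK3 (fun l : Fin (n + 1) => d l.succ - d 0) (b 0) (fun l : Fin (n + 1) => -(b l.succ)) x := by
  have hd0 : ∀ l, d 0 ≤ d l := fun l => hd.monotone (Fin.zero_le l)
  have hx0 : 0 < x := hu.trans hx.1
  have hv : 0 < v := hu.trans (hx.1.trans hx.2)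
  set lam : Fin (n + 1) → ℕ := fun l => d l.succ - d 0 with hlam
  have hlam_ne : lam l₀ ≠ 0 := by
    have : d 0 < d l₀.succ := hd (Fin.succ_pos l₀)
    simp only [hlam]; omega
  have hl0 : b l₀.succ ≠ 0 := fun h => by rw [h, mul_zero] at hpole; exact lt_irrefl _ hpole
  have hB : ∀ l, l ≠ l₀ → (fun l : Fin (n + 1) => -(b l.succ)) l = 0 := fun l hl => by simp [hzero l hl]
  have hrs := row_single lam (b 0) (fun l : Fin (n + 1) => -(b l.succ)) l₀ hB
  have hevw : ∀ w, (∑ l, C (b l) * X ^ (d l) : ℝ[X]).eval w = w ^ (d 0) * (b 0 + b l₀.succ * w ^ (lam l₀)) := by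
    intro w
    rw [eval_rowK_eq d hd0 b w, row_single lam (b 0) (fun l : Fin (n + 1) => -(b l.succ)) l₀ hB]; ring
  have hend' : 0 ≤ (b 0 + b l₀.succ * u ^ (lam l₀)) * (b 0 + b l₀.succ * v ^ (lam l₀)) := by
    rw [hevw, hevw] at hend
    have hpow : 0 < u ^ (d 0) * v ^ (d 0) := mul_pos (pow_pos hu _) (pow_pos hv _)
    have : u ^ (d 0) * (b 0 + b l₀.succ * u ^ (lam l₀)) * (v ^ (d 0) * (b 0 + b l₀.succ * v ^ (lam l₀)))
        = (u ^ (d 0) * v ^ (d 0)) * ((b 0 + b l₀.succ * u ^ (lam l₀)) * (b 0 + b l₀.succ * v ^ (lam l₀))) := by ring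
    rw [this] at hend
    exact (mul_nonneg_iff_of_pos_left hpow).1 hend
  have hne : b 0 + b l₀.succ * x ^ (lam l₀) ≠ 0 :=
    binomial_ne_zero_of_endpoints (b 0) (b l₀.succ) hlam_ne hu hx hend' hl0
  have hF : b 0 - ∑ l : Fin (n + 1), (-(b l.succ)) * x ^ (lam l) ≠ 0 := by
    rw [hrs]
    have : b 0 - -(b l₀.succ) * x ^ (lam l₀) = b 0 + b l₀.succ * x ^ (lam l₀) := by ring
    rwa [this]
  refine ⟨hF, ?_⟩
  have hlaw := rowPsiK3_single_law lam (b 0) (fun l : Fin (n + 1) => -(b l.succ)) l₀ hB x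
  have hAB : 0 < b 0 * (fun l : Fin (n + 1) => -(b l.succ)) l₀ := by simp only; nlinarith
  have hψ : 0 < rowPsiK1 lam (b 0) (fun l : Fin (n + 1) => -(b l.succ)) x :=
    rowPsiK1_single_pos lam (b 0) (fun l : Fin (n + 1) => -(b l.succ)) l₀ hB hx0 hlam_ne hAB hF
  have hsq : 0 < rowPsiK1 lam (b 0) (fun l : Fin (n + 1) => -(b l.succ)) x ^ 2 := by positivity
  have hp0 : (0 : ℝ) ≤ (p : ℝ) := Nat.cast_nonneg p
  have hpq : (p : ℝ) ≤ ((lam l₀ : ℕ) : ℝ) := by exact_mod_cast hrate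
  have hpq2 : (p : ℝ) ^ 2 ≤ ((lam l₀ : ℕ) : ℝ) ^ 2 := by nlinarith
  nlinarith

/-- **ROW LAW, binomial pole on a pair of tail letters** (`(d_{i+1}, d_{j+1})`, `i < j`, `b₀ = 0`, `b_{i+1}b_{j+1} < 0`, rate `d_{j+1} − d_{i+1} ≥ p`, root outside
`(u,v)`): on `(u,v)` the stripped row is non-zero and `p²ψ₁ < ψ₃` (✓ `rowPsiK3_pair_law`, ✓ `rowPsiK1_pair_pos`). [this file's theorem] -/
theorem rowLawsAt_pair_pole {n : ℕ} (d : Fin (n + 2) → ℕ) (hd : StrictMono d) (b : Fin (n + 2) → ℝ) {u v : ℝ} (hu : 0 < u) (p : ℕ)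
    (i j : Fin (n + 1)) (hij : i < j) (hb0 : b 0 = 0) (hzero : ∀ l : Fin (n + 1), l ≠ i → l ≠ j → b l.succ = 0)
    (hneg : b i.succ * b j.succ < 0) (hrate : p ≤ d j.succ - d i.succ)
    (hend : 0 ≤ (∑ l, C (b l) * X ^ (d l) : ℝ[X]).eval u * (∑ l, C (b l) * X ^ (d l) : ℝ[X]).eval v)
    {x : ℝ} (hx : x ∈ Ioo u v) :
    b 0 - ∑ l : Fin (n + 1), (-(b l.succ)) * x ^ (d l.succ - d 0) ≠ 0 ∧
    (p : ℝ) ^ 2 * rowPsiK1 (fun l : Fin (n + 1) => d l.succ - d 0) (b 0) (fun l : Fin (n + 1) => -(b l.succ)) x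
      < rowPsiK3 (fun l : Fin (n + 1) => d l.succ - d 0) (b 0) (fun l : Fin (n + 1) => -(b l.succ)) x := by
  have hd0 : ∀ l, d 0 ≤ d l := fun l => hd.monotone (Fin.zero_le l)
  have hx0 : 0 < x := hu.trans hx.1
  have hv : 0 < v := hu.trans (hx.1.trans hx.2)
  have hj : b j.succ ≠ 0 := fun h => by rw [h, mul_zero] at hneg; exact lt_irrefl _ hneg
  have hij' : (i : Fin (n + 1)) ≠ j := ne_of_lt hij
  set lam : Fin (n + 1) → ℕ := fun l => d l.succ - d 0 with hlam
  have hB : ∀ l, l ≠ i → l ≠ j → (fun l : Fin (n + 1) => -(b l.succ)) l = 0 := fun l h1 h2 => by simp [hzero l h1 h2]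
  have hμ : lam j - lam i = d j.succ - d i.succ := by
    show (d j.succ - d 0) - (d i.succ - d 0) = d j.succ - d i.succ
    have := hd0 i.succ; omega
  have hμpos : lam i < lam j := by
    show d i.succ - d 0 < d j.succ - d 0
    have := hd0 i.succ; have := hd (Fin.succ_lt_succ_iff.2 hij); omega
  have hcastμ : (((lam j : ℕ) : ℝ) - ((lam i : ℕ) : ℝ)) = ((d j.succ - d i.succ : ℕ) : ℝ) := by
    rw [← hμ, Nat.cast_sub hμpos.le]
  have hrow : b 0 - ∑ l : Fin (n + 1), (-(b l.succ)) * x ^ (lam l) = x ^ (lam i) * (b i.succ + b j.succ * x ^ (lam j - lam i)) := by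
    rw [hb0, row_pair lam 0 (fun l : Fin (n + 1) => -(b l.succ)) i j hij' hB]
    have : x ^ (lam j) = x ^ (lam i) * x ^ (lam j - lam i) := by rw [← pow_add, Nat.add_sub_cancel' hμpos.le]
    rw [this]; ring
  have hevw : ∀ w, (∑ l, C (b l) * X ^ (d l) : ℝ[X]).eval w
      = w ^ (d 0) * (w ^ (lam i) * (b i.succ + b j.succ * w ^ (lam j - lam i))) := by
    intro w
    rw [eval_rowK_eq d hd0 b w, hb0, row_pair lam 0 (fun l : Fin (n + 1) => -(b l.succ)) i j hij' hB]
    have : w ^ (lam j) = w ^ (lam i) * w ^ (lam j - lam i) := by rw [← pow_add, Nat.add_sub_cancel' hμpos.le]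
    rw [this]; ring
  have hne : b i.succ + b j.succ * x ^ (lam j - lam i) ≠ 0 := by
    have hend' : 0 ≤ (b i.succ + b j.succ * u ^ (lam j - lam i)) * (b i.succ + b j.succ * v ^ (lam j - lam i)) := by
      rw [hevw, hevw] at hend
      have hpw : 0 < (u ^ (d 0) * u ^ (lam i)) * (v ^ (d 0) * v ^ (lam i)) := by positivity
      have : u ^ (d 0) * (u ^ (lam i) * (b i.succ + b j.succ * u ^ (lam j - lam i)))
          * (v ^ (d 0) * (v ^ (lam i) * (b i.succ + b j.succ * v ^ (lam j - lam i))))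
          = ((u ^ (d 0) * u ^ (lam i)) * (v ^ (d 0) * v ^ (lam i)))
            * ((b i.succ + b j.succ * u ^ (lam j - lam i)) * (b i.succ + b j.succ * v ^ (lam j - lam i))) := by ring
      rw [this] at hend
      exact (mul_nonneg_iff_of_pos_left hpw).1 hend
    exact binomial_ne_zero_of_endpoints (b i.succ) (b j.succ) (by have := hμpos; omega) hu hx hend' hj
  have hF : b 0 - ∑ l : Fin (n + 1), (-(b l.succ)) * x ^ (lam l) ≠ 0 := by
    rw [hrow]; exact mul_ne_zero (pow_ne_zero _ hx0.ne') hne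
  have hF0 : (0 : ℝ) - ∑ l : Fin (n + 1), (-(b l.succ)) * x ^ (lam l) ≠ 0 := by rwa [hb0] at hF
  refine ⟨hF, ?_⟩
  rw [hb0]
  have hlaw := rowPsiK3_pair_law lam (fun l : Fin (n + 1) => -(b l.succ)) i j hij' hB hF0
  rw [hcastμ] at hlaw
  have hBB : (fun l : Fin (n + 1) => -(b l.succ)) i * (fun l : Fin (n + 1) => -(b l.succ)) j < 0 := by simp only; nlinarith
  have hψ := rowPsiK1_pair_pos lam (fun l : Fin (n + 1) => -(b l.succ)) i j hij' hB hx0 (ne_of_lt hμpos) hBB hF0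
  have hp0 : (0 : ℝ) ≤ (p : ℝ) := Nat.cast_nonneg p
  have hpq : (p : ℝ) ≤ ((d j.succ - d i.succ : ℕ) : ℝ) := by exact_mod_cast hrate
  have hpq2 : (p : ℝ) ^ 2 ≤ ((d j.succ - d i.succ : ℕ) : ℝ) ^ 2 := by nlinarith
  have hsq : 0 < rowPsiK1 lam 0 (fun l : Fin (n + 1) => -(b l.succ)) x ^ 2 := by positivity
  nlinarith

/-- **ROW LAW, cloud at threshold `p`** (`b₀ > 0`, all `b_{l+1} ≤ 0`, some `b_{l+1} ≠ 0`, every ACTIVE tail letter of rate `d_{l+1} − d₀ ≥ p`, `f(v) > 0`):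
on `(u,v)` the stripped row is positive and `p²ψ₁ < ψ₃` (✓ `rowPsiK3_gt_support`). [this file's theorem] -/
theorem rowLawsAt_cloud {n : ℕ} (d : Fin (n + 2) → ℕ) (hd : StrictMono d) (b : Fin (n + 2) → ℝ) {u v : ℝ} (hu : 0 < u) (p : ℕ)
    (hle : ∀ l : Fin (n + 1), b l.succ ≤ 0) (hne : ∃ l : Fin (n + 1), b l.succ ≠ 0)
    (hrate : ∀ l : Fin (n + 1), b l.succ ≠ 0 → p ≤ d l.succ - d 0)
    (hvpos : 0 < (∑ l, C (b l) * X ^ (d l) : ℝ[X]).eval v)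
    {x : ℝ} (hx : x ∈ Ioo u v) :
    b 0 - ∑ l : Fin (n + 1), (-(b l.succ)) * x ^ (d l.succ - d 0) ≠ 0 ∧
    (p : ℝ) ^ 2 * rowPsiK1 (fun l : Fin (n + 1) => d l.succ - d 0) (b 0) (fun l : Fin (n + 1) => -(b l.succ)) x
      < rowPsiK3 (fun l : Fin (n + 1) => d l.succ - d 0) (b 0) (fun l : Fin (n + 1) => -(b l.succ)) x := by
  have hd0 : ∀ l, d 0 ≤ d l := fun l => hd.monotone (Fin.zero_le l)
  have hx0 : 0 < x := hu.trans hx.1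
  have hv : 0 < v := hu.trans (hx.1.trans hx.2)
  set lam : Fin (n + 1) → ℕ := fun l => d l.succ - d 0 with hlam
  have hlam_ne : ∀ l : Fin (n + 1), lam l ≠ 0 := by
    intro l
    have : d 0 < d l.succ := hd (Fin.succ_pos l)
    simp only [hlam]; omega
  have hB0 : ∀ l, 0 ≤ (fun l : Fin (n + 1) => -(b l.succ)) l := fun l => by simp only; linarith [hle l]
  have hposg : 0 < b 0 - ∑ l : Fin (n + 1), (-(b l.succ)) * x ^ (lam l) := by
    rw [eval_rowK_eq d hd0 b v] at hvpos
    have h3 : 0 < b 0 - ∑ l : Fin (n + 1), (-(b l.succ)) * v ^ (lam l) := (mul_pos_iff_of_pos_left (pow_pos hv _)).1 hvpos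
    have hmono : ∑ l : Fin (n + 1), (-(b l.succ)) * x ^ (lam l) ≤ ∑ l : Fin (n + 1), (-(b l.succ)) * v ^ (lam l) :=
      Finset.sum_le_sum fun l _ => mul_le_mul_of_nonneg_left (pow_le_pow_left₀ hx0.le hx.2.le _) (hB0 l)
    linarith
  refine ⟨hposg.ne', ?_⟩
  have hH1 : 0 < rowHK lam 1 (fun l : Fin (n + 1) => -(b l.succ)) x := by
    obtain ⟨l₁, hl₁'⟩ := hne
    have hl₁ : b l₁.succ < 0 := lt_of_le_of_ne (hle l₁) hl₁'
    unfold rowHK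
    refine Finset.sum_pos' (fun l _ => mul_nonneg (mul_nonneg (by positivity) (hB0 l)) (pow_pos hx0 _).le)
      ⟨l₁, Finset.mem_univ _, ?_⟩
    have hl1 : (0 : ℝ) < ((lam l₁ : ℕ) : ℝ) := by exact_mod_cast Nat.pos_of_ne_zero (hlam_ne l₁)
    simp only [pow_one]
    exact mul_pos (mul_pos hl1 (by linarith)) (pow_pos hx0 _)
  have hrate' : ∀ l : Fin (n + 1), (fun l : Fin (n + 1) => -(b l.succ)) l ≠ 0 → p ≤ lam l := fun l hl =>
    hrate l (by simpa using hl)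
  exact rowPsiK3_gt_support lam (b 0) (fun l : Fin (n + 1) => -(b l.succ)) p hx0 hB0 hrate' hposg hH1

end ProductPlusOne

end Summit.ValiantsHypothesis.ValiantsHypothesis.Theorems.LacunarySymmetroidMatrixDescartes
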